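import Summits.BirchSwinnertonDyer.BirchSwinnertonDyer.Theorems.KatoDescentTamePotSupersingularJetchevIrreducibleReadingThm52CebotarevAdapter
import Summits.BirchSwinnertonDyer.Rank1Residual.X9.LeafDischargeKolyvaginCebotarev
import Summits.BirchSwinnertonDyer.BirchSwinnertonDyer.Theorems.ErratumRoadFiveShimuraKolyvaginOrderBoundInertShiftCebotarev
import Summits.BirchSwinnertonDyer.BirchSwinnertonDyer.Theorems.ClassRecordThreeShimuraKolyvaginFixedOfTorsion
import Literature.NumberTheory.EllipticCurves.BSDSelmerCMPConverseHeegnerFieldProofs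
import HarnessLib

/-!
# Route `PrintX9`, crux J = `HeegnerDivisibilityX9` (item 20392), stub `stub_jetchevX9` — toward the X9 reading
# `CoreVertexExistenceX9` (Jetchev 2008 Prop. 5.3 «core vertices exist»): step 1, the walk's Čebotarev input WITH LEVEL
# SHIFT on an X9 Heegner frame (`ClassX9 W p`, `K` Heegner for `N_E` with `p` SPLIT): [J] Lemma 6.1 / [McC] Cor. 3.2 for
# classes of level `p^M` and Kolyvagin primes of DEPTH `M + k` — UNCONDITIONAL

Cell `bsd-print-x9` (print tier, key `x9`), prover seat p4; `--supports stmt-BirchSwinnertonDyer-20392`,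
helper; THEOREMS ONLY, nothing booked, no item closed, BSD is not proved by any of this.

WHAT. bsd-potss k9-c4 g10's `JetchevIrreducibleCoreVertex.cor32_localOrder_shift_of_irreducible_of_heegner` /
`exists_kolyvaginPrime_addOrderOf_localization_eq_shift_of_irreducible_of_heegner` (the level shift of cell bsd-stepL
shim-p1's `McCallum1991_cor_3_2_pow_shift_of_chebotarev` run on k8t-c4 g9's irreducible one-level Cor. 3.2 at `p ∣ N_E`)
with the one-level theorem replaced by ty2's UNCONDITIONAL X9 Cor. 3.2 `ClassX9.cor32_localOrder_of_heegner` (file F of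
the cell's discharge interface: Gross disjointness from (Heeg) + `p` split, the scalar `a ≢ 1` of the non-surjective
irreducible image, simplicity and scalar commutant over `K`) and the row binders `(¬CM, Irr, p ∣ N_E)` replaced by
`(hX9 : ClassX9 W p, hHp : SatisfiesHeegnerHypothesis p K)`; proofs byte-for-byte otherwise (injectivity of
`ι_* : H¹(K,E[p^M]) ↪ H¹(K,E[p^{M+k}])` from `E(K)[p] = 0` by irreducibility; `Γ_{K_λ}` fixes `E[p^{M+k}]` above a
Kolyvagin prime of depth `M + k`). §1 `cor32_localOrder_shift_of_classX9_of_heegner`; §2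
`exists_kolyvaginPrime_addOrderOf_localization_eq_shift_of_classX9_of_heegner` — the `h61`-with-shift input of bsd-jet's
kernel walk `JET.Section6.exists_coreVertex_adm` (Prop. 6.4) on X9 frames, the X9 twin of tam3-p1's
`Koly.exists_kolyvaginPrime_addOrderOf_localization_eq_shift` (surjective) — UNCONDITIONAL.
References: [cite: Jetchev2008, Lemma 5.1 (p. 821) = arXiv Lemma 6.1, Rem. 6.2] [cite: McCallumLMS1991, §3 Prop. 3.1,
Cor. 3.2 (p. 299), §4 Lemma 4.6] [cite: GrossLMS1991, §3 (3.1)–(3.3), Lemma 4.3, §9] [cite: WZhang2014, Notations (xii)].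
-/

set_option autoImplicit false

noncomputable section

open scoped Classical Pointwise NumberField

namespace Summit.BirchSwinnertonDyer.Rank1Residual.JET.Split

open WeierstrassCurve NumberField IsDedekindDomain Field
  Literature.NumberTheory.EllipticCurves Literature.NumberTheory.GaloisRepresentations
  Summit.BirchSwinnertonDyer.Rank1Residual Summit.BirchSwinnertonDyer.Rank1Residual.JET
  Summit.BirchSwinnertonDyer.BirchSwinnertonDyer.Theorems
  Literature.NumberTheory.EllipticCurves.Rank1Residual

/-! ### §1 McCallum's Cor. 3.2 one level deeper on an X9 Heegner frame -/

/-- **[McC] Cor. 3.2 ONE LEVEL DEEPER on an X9 Heegner frame** (Kolyvagin primes of depth `M + k`, prescribed local orders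
of level-`p^M` classes): for an X9 pair `(E, p)` (`ClassX9 W p`), `K` imaginary quadratic with the Heegner hypothesis for
`N_E` and `p` split, `c ≠ 1` in `Aut(K/ℚ)`, `M ≥ 1`, non-zero independent `c`-eigenclasses
`c_i ∈ H¹(K, E[p^M])` of orders `p^{M_i}` and `N_i ≤ M_i`: the set of primes `ℓ` with `Frob ℓ = Frob ∞` on `E[p^{M+k}]`,
`ℓ` a Zhang–Kolyvagin prime (for the level `N`) of index `≥ M + k`, and `p^j c_{i,λ} = 0 ↔ N_i ≤ j` at the place `λ ∋ ℓ`,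
is INFINITE. shim-p1's level shift run on ty2's UNCONDITIONAL one-level X9 theorem `ClassX9.cor32_localOrder_of_heegner`.
[cite: McCallumLMS1991, §3 Cor. 3.2, §4 Lemma 4.6] [cite: Jetchev2008, Lemma 5.1, Rem. 6.2] [cite: GrossLMS1991, Lemma 4.3, §9] -/
theorem cor32_localOrder_shift_of_classX9_of_heegner (N : ℕ) [NeZero N] (W : WeierstrassCurve ℚ)
    [W.IsElliptic] [W.IsGloballyMinimal] (K : Type) [Field K] [NumberField K]
    (hK : IsImaginaryQuadratic K) (hHg : SatisfiesHeegnerHypothesis (W.conductorNorm ℤ) K)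
    (p : ℕ) [Fact p.Prime] (hX9 : ClassX9 W p) (hHp : SatisfiesHeegnerHypothesis p K)
    (c : K ≃ₐ[ℚ] K) (hc : c ≠ 1) (M : ℕ) (hM : 1 ≤ M) (k : ℕ)
    (r : ℕ) (cs : Fin r → galH1Torsion (W.baseChange K) ((p ^ M : ℕ) : ℤ))
    (h0 : ∀ i, cs i ≠ 0)
    (hτ : ∀ i, ∃ e : ℤ, (e = 1 ∨ e = -1) ∧ conjAct W c ((p ^ M : ℕ) : ℤ) (cs i) = e • cs i)
    (hind : ∀ b : Fin r → ℤ, ∑ i, b i • cs i = 0 → ∀ i, (addOrderOf (cs i) : ℤ) ∣ b i)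
    (Mi : Fin r → ℕ) (hMi : ∀ i, addOrderOf (cs i) = p ^ Mi i)
    (Nv : Fin r → ℕ) (hNv : ∀ i, Nv i ≤ Mi i) :
    Set.Infinite {ℓ : ℕ | FrobEqFrobInfty W K (p ^ (M + k)) ℓ ∧
      Zhang2014.IsKolyvaginPrime N W K p ℓ ∧ M + k ≤ Zhang2014.kolyvaginIndex W p ℓ ∧
      ∀ i, ∀ v : HeightOneSpectrum (𝓞 K), (ℓ : 𝓞 K) ∈ v.asIdeal →
        ∀ j : ℕ, ((p ^ j : ℕ) : ℤ) • cs i ∈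
            (W.baseChange K).torsionLocalKer (v.adicCompletion K) ((p ^ M : ℕ) : ℤ) ↔ Nv i ≤ j} := by
  classical
  have hp : p.Prime := Fact.out
  haveI : (W.baseChange K).IsElliptic := inferInstanceAs (W.map (algebraMap ℚ K)).IsElliptic
  have hdvd := natCast_pow_dvd_natCast_pow_add p M k
  set ι := torsionH1OfDvd (W.baseChange K) hdvd with hιdef
  -- injectivity of the level change from `E(K)[p] = 0` (irreducible image)
  have hιinj : Function.Injective ι :=
    ShimuraKolyvaginFixedOfTorsion.torsionH1OfDvd_pow_injective_of_torsionBy_eq_bot W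
      (torsionBy_eq_bot_of_isImaginaryQuadratic_of_hasIrreducibleModPGaloisRep W K hK hp hX9.irr) M k
  -- ### the shifted classes `ι_* c_i ∈ H¹(K, E[p^{M+k}])`
  set cs' : Fin r → galH1Torsion (W.baseChange K) ((p ^ (M + k) : ℕ) : ℤ) := fun i ↦ ι (cs i)
    with hcs'
  have h0' : ∀ i, cs' i ≠ 0 := fun i h ↦ h0 i (hιinj (by rw [map_zero]; exact h))
  have hτ' : ∀ i, ∃ e : ℤ, (e = 1 ∨ e = -1) ∧
      conjAct W c ((p ^ (M + k) : ℕ) : ℤ) (cs' i) = e • cs' i := fun i ↦ by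
    obtain ⟨e, he, hec⟩ := hτ i
    exact ⟨e, he, by rw [hcs', conjAct_torsionH1OfDvd, hec, map_zsmul]⟩
  have hord' : ∀ i, addOrderOf (cs' i) = addOrderOf (cs i) := fun i ↦ by
    refine (addOrderOf_injective (AddMonoidHom.mk' (fun x ↦ ι x) (fun x y ↦ map_add ι x y)) ?_ (cs i))
    intro x y hxy
    exact hιinj hxy
  have hind' : ∀ b : Fin r → ℤ, ∑ i, b i • cs' i = 0 → ∀ i, (addOrderOf (cs' i) : ℤ) ∣ b i := by
    intro b hb i
    have hsum : ι (∑ j, b j • cs j) = 0 := by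
      rw [map_sum]
      simpa only [map_zsmul] using hb
    rw [hord']
    exact hind b (hιinj (by rw [hsum, map_zero])) i
  have hMi' : ∀ i, addOrderOf (cs' i) = p ^ Mi i := fun i ↦ (hord' i).trans (hMi i)
  -- ### the bound: above the rational primes under the bad places of `E/K`
  have hbad : ((W.baseChange K).badPlaces (𝓞 K)).Finite := (W.baseChange K).finite_badPlaces_holds (𝓞 K)
  set B : ℕ := hbad.toFinset.sup fun w ↦ (Rat.HeightOneSpectrum.primesEquiv (w.under (𝓞 ℚ)) : ℕ)
    with hB
  have hM' : 1 ≤ M + k := le_trans hM (Nat.le_add_right M k)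
  -- ### ty2's UNCONDITIONAL X9 Cor. 3.2 at level `p^{M+k}` (file F)
  have hinf := hX9.cor32_localOrder_of_heegner N K hK hHg hHp c hc (M + k) hM' r cs' h0' hτ' hind' Mi hMi' Nv hNv
  refine (hinf.sdiff (Set.finite_le_nat B)).mono ?_
  rintro ℓ ⟨⟨hfrob, hZ, hidx, hloc⟩, hBℓ⟩
  have hBℓ' : B < ℓ := lt_of_not_ge hBℓ
  -- the Gross–Kolyvagin structure of `ℓ` (for the place API): `Frob ℓ = Frob ∞` on `E[p] ⊆ E[p^{M+k}]`
  have hKol : IsKolyvaginPrime N W K p ℓ :=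
    ⟨hZ.1, hZ.2.1, hZ.2.2.1, hZ.2.2.2.1, hZ.2.2.2.2.1,
      hfrob.of_dvd (dvd_pow_self p (by omega : M + k ≠ 0))⟩
  -- ### good reduction at `λ`
  have hgood : hKol.place ∉ (W.baseChange K).badPlaces (𝓞 K) := by
    intro hmem
    have hle : (Rat.HeightOneSpectrum.primesEquiv (hKol.place.under (𝓞 ℚ)) : ℕ) ≤ B :=
      Finset.le_sup (f := fun w : HeightOneSpectrum (𝓞 K) ↦
        (Rat.HeightOneSpectrum.primesEquiv (w.under (𝓞 ℚ)) : ℕ)) (hbad.mem_toFinset.mpr hmem)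
    have hℓeq : (Rat.HeightOneSpectrum.primesEquiv (hKol.place.under (𝓞 ℚ)) : ℕ) = ℓ := by
      rw [(natCast_mem_asIdeal_iff_eq_primesEquiv_symm _ hKol.prime).mp hKol.natCast_mem_under,
        Equiv.apply_symm_apply]
    omega
  -- ### `Γ_{K_λ}` fixes `E[p^{M+k}]`
  haveI : NeZero (p ^ (M + k)) := ⟨pow_ne_zero _ hp.ne_zero⟩
  have hpv : ((p : ℕ) : 𝓞 K) ∉ hKol.place.asIdeal :=
    not_natCast_mem_of_prime_ne hKol.prime hp hKol.2.2.2.1 hKol.place hKol.mem_place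
  have hqv : ((((p ^ (M + k) : ℕ) : ℤ)) : 𝓞 K) ∉ hKol.place.asIdeal := by
    rw [Int.cast_natCast, Nat.cast_pow]
    exact fun h ↦ hpv (hKol.place.isPrime.mem_of_pow_mem (M + k) h)
  have htriv : ∀ (g : absoluteGaloisGroup (hKol.place.adicCompletion K))
      (Q : geomTorsion (W.baseChange K) ((p ^ (M + k) : ℕ) : ℤ)),
      resGal (K := K) (hKol.place.adicCompletion K) g • Q = Q := fun g Q ↦ by
    rw [resGal_eq_absGaloisRestrict]
    exact absGaloisRestrict_smul_geomTorsion_eq_of_kolyvaginPrime W hK hKol hfrob hgood hqv g Q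
  -- ### assemble
  refine ⟨hfrob, hZ, hidx, fun i v hv j ↦ ?_⟩
  rw [hKol.mem_iff.mp hv]
  have key := hloc i hKol.place hKol.mem_place j
  have hpd : p ^ M ∣ p ^ (M + k) := pow_dvd_pow p (Nat.le_add_right M k)
  have hpM : p ^ M ≠ 0 := pow_ne_zero M hp.ne_zero
  have hpMk : p ^ (M + k) ≠ 0 := pow_ne_zero _ hp.ne_zero
  have e1 := mem_torsionLocalKer_iff_torsionH1OfDvd_mem (W.baseChange K) (hKol.place.adicCompletion K)
    hpd hpM hpMk htriv (((p ^ j : ℕ) : ℤ) • cs i)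
  rw [map_zsmul] at e1
  exact e1.trans key

/-! ### §2 [J] Lemma 6.1 decoupled (level `p^k`, index `≥ k + j`) on an X9 Heegner frame -/

/-- **[J] Lemma 6.1 (= [McC] Cor. 3.2) DECOUPLED in the walk's localisation currency on an X9 Heegner frame (`ClassX9 W p`,
`p` split in `K`) — UNCONDITIONAL.** For `τ`-eigenclasses `x` (sign `e`) and `y ≠ 0` (sign `−e`) in `H¹(K, E[p^k])`, `k ≥ 1`,
a shift `j` and any bound `b`: a Zhang–Kolyvagin prime `ℓ > b` of index `M(ℓ) ≥ k + j` such that the localisation at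
the place of `K` above `ℓ` PRESERVES the orders of `x` and `y`. = tam3-p1's
`Koly.exists_kolyvaginPrime_addOrderOf_localization_eq_shift` with `ρ̄ onto` replaced by {`ClassX9 W p`, Heegner for `N_E`,
`p` split}; proof = k8t-c4 g9's one-level adapter over `cor32_localOrder_shift_of_classX9_of_heegner`.
[cite: Jetchev2008, Lemma 5.1 (p. 821), Rem. 6.2] [cite: McCallumLMS1991, §3 Cor. 3.2 (p. 299), §4 Lemma 4.6] -/
theorem exists_kolyvaginPrime_addOrderOf_localization_eq_shift_of_classX9_of_heegner
    (W : WeierstrassCurve ℚ) [W.IsElliptic] [W.IsGloballyMinimal] [NeZero (W.conductorNorm ℤ)]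
    (K : Type) [Field K] [NumberField K] (hK : IsImaginaryQuadratic K)
    (hH : SatisfiesHeegnerHypothesis (W.conductorNorm ℤ) K)
    (p : ℕ) [Fact p.Prime] (hX9 : ClassX9 W p) (hHp : SatisfiesHeegnerHypothesis p K)
    (τ : K ≃ₐ[ℚ] K) (hτ : τ ≠ 1) {k : ℕ} (hk : 1 ≤ k) (j : ℕ) {e : ℤ} (he : e = 1 ∨ e = -1)
    (x y : galH1Torsion (W.baseChange K) ((p ^ k : ℕ) : ℤ))
    (hx : conjAct W τ ((p ^ k : ℕ) : ℤ) x = e • x) (hy : conjAct W τ ((p ^ k : ℕ) : ℤ) y = (-e) • y)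
    (hy0 : y ≠ 0) (b : ℕ) :
    ∃ ℓ : ℕ, b < ℓ ∧ Zhang2014.IsKolyvaginPrime (W.conductorNorm ℤ) W K p ℓ ∧
      k + j ≤ Zhang2014.kolyvaginIndex W p ℓ ∧
      ∀ v : HeightOneSpectrum (𝓞 K), (ℓ : 𝓞 K) ∈ v.asIdeal →
        addOrderOf (galoisCohomology.localization
            ((W.baseChange K).torsionGaloisModule ((p ^ k : ℕ) : ℤ)) (Sum.inr v) 1 x) = addOrderOf x ∧
        addOrderOf (galoisCohomology.localization
            ((W.baseChange K).torsionGaloisModule ((p ^ k : ℕ) : ℤ)) (Sum.inr v) 1 y) = addOrderOf y := by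
  have hp : p.Prime := Fact.out
  have hp2 : p ≠ 2 := hX9.ne_two
  -- every class is killed by `p^k`, so orders are powers of `p` (and prime to `2`)
  have hkill : ∀ z : galH1Torsion (W.baseChange K) ((p ^ k : ℕ) : ℤ), p ^ k • z = 0 := fun z ↦
    galoisCohomology.nsmul_eq_zero_of_forall ((W.baseChange K).torsionGaloisModule ((p ^ k : ℕ) : ℤ))
      (fun T ↦ by
        have h := (W.baseChange K).natAbs_nsmul_geomTorsion T
        rwa [Int.natAbs_natCast] at h) z
  have hordpow : ∀ z : galH1Torsion (W.baseChange K) ((p ^ k : ℕ) : ℤ), ∃ a ≤ k, addOrderOf z = p ^ a :=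
    fun z ↦ (Nat.dvd_prime_pow hp).mp (addOrderOf_dvd_of_nsmul_eq_zero (hkill z))
  have hcop2 : ∀ z : galH1Torsion (W.baseChange K) ((p ^ k : ℕ) : ℤ), (addOrderOf z).Coprime 2 := by
    intro z
    obtain ⟨a, -, ha⟩ := hordpow z
    rw [ha]
    exact Nat.Coprime.pow_left _ ((Nat.coprime_primes hp Nat.prime_two).mpr hp2)
  -- the localisation at the place `v`, typed on `galH1Torsion` (= `galoisCohomology _ 1` by `rfl`)
  let loc : ∀ v : HeightOneSpectrum (𝓞 K), galH1Torsion (W.baseChange K) ((p ^ k : ℕ) : ℤ) →+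
      galoisCohomology (((W.baseChange K).torsionGaloisModule ((p ^ k : ℕ) : ℤ)).toLocal (Sum.inr v)) 1 :=
    fun v ↦ galoisCohomology.localization ((W.baseChange K).torsionGaloisModule ((p ^ k : ℕ) : ℤ))
      (Sum.inr v) 1
  -- dictionary: multiples in `torsionLocalKer` = multiples killed by the localisation
  have hloc : ∀ (v : HeightOneSpectrum (𝓞 K)) (z : galH1Torsion (W.baseChange K) ((p ^ k : ℕ) : ℤ))
      (a : ℕ), loc v (p ^ a • z) = 0 ↔
        ((p ^ a : ℕ) : ℤ) • z ∈ (W.baseChange K).torsionLocalKer (v.adicCompletion K) ((p ^ k : ℕ) : ℤ) := by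
    intro v z a
    haveI : CharZero (v.adicCompletion K) := charZero_of_injective_algebraMap (algebraMap K _).injective
    rw [natCast_zsmul, mem_torsionLocalKer_iff_res_eq_zero (W := W.baseChange K)
      (E := v.adicCompletion K) (pow_ne_zero k hp.ne_zero)]
    exact Iff.rfl
  obtain ⟨b', -, hb'⟩ := hordpow y
  have hey : (-e = 1 ∨ -e = -1) := by rcases he with rfl | rfl <;> norm_num
  -- apply the shifted Cor. 3.2 to an independent system of eigenclasses containing `y` (and `x` if `x ≠ 0`)
  have key : ∃ T : Set ℕ, T.Infinite ∧ ∀ ℓ ∈ T, Zhang2014.IsKolyvaginPrime (W.conductorNorm ℤ) W K p ℓ ∧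
      k + j ≤ Zhang2014.kolyvaginIndex W p ℓ ∧ ∀ v : HeightOneSpectrum (𝓞 K), (ℓ : 𝓞 K) ∈ v.asIdeal →
        addOrderOf (loc v x) = addOrderOf x ∧ addOrderOf (loc v y) = addOrderOf y := by
    by_cases hx0 : x = 0
    · -- the system `(y)`
      have hinf := cor32_localOrder_shift_of_classX9_of_heegner (W.conductorNorm ℤ) W K hK hH p hX9 hHp τ hτ k hk j 1
        ![y]
        (by intro i; fin_cases i; exact hy0)
        (by intro i; fin_cases i; exact ⟨-e, hey, hy⟩)
        (by
          intro a ha i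
          fin_cases i
          have ha' : a 0 • y = 0 := by simpa using ha
          exact addOrderOf_dvd_iff_zsmul_eq_zero.mpr ha')
        ![b'] (by intro i; fin_cases i; exact hb') ![b'] (fun _ ↦ le_rfl)
      refine ⟨_, hinf, fun ℓ hℓ ↦ ⟨hℓ.2.1, hℓ.2.2.1, fun v hv ↦
        ⟨by rw [hx0, map_zero, addOrderOf_zero, addOrderOf_zero], ?_⟩⟩⟩
      rw [hb']
      exact addOrderOf_map_eq_of_forall_map_nsmul_eq_zero_iff (loc v) hp fun j' ↦ by
        rw [hloc v y j']; simpa using hℓ.2.2.2 0 v hv j'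
    · -- the system `(x, y)`
      obtain ⟨a', -, ha'⟩ := hordpow x
      have hinf := cor32_localOrder_shift_of_classX9_of_heegner (W.conductorNorm ℤ) W K hK hH p hX9 hHp τ hτ k hk j 2
        ![x, y]
        (by
          intro i
          fin_cases i
          · exact hx0
          · exact hy0)
        (by
          intro i
          fin_cases i
          · exact ⟨e, he, hx⟩
          · exact ⟨-e, hey, hy⟩)
        (by
          intro c hc i
          have hc' : c 0 • x + c 1 • y = 0 := by simpa [Fin.sum_univ_two] using hc
          obtain ⟨h0, h1⟩ := dvd_of_zsmul_add_zsmul_eq_zero_of_eigen (conjAct W τ ((p ^ k : ℕ) : ℤ)) he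
            hx hy (hcop2 x) (hcop2 y) hc'
          fin_cases i
          · exact h0
          · exact h1)
        ![a', b']
        (by
          intro i
          fin_cases i
          · exact ha'
          · exact hb')
        ![a', b'] (fun _ ↦ le_rfl)
      refine ⟨_, hinf, fun ℓ hℓ ↦ ⟨hℓ.2.1, hℓ.2.2.1, fun v hv ↦ ⟨?_, ?_⟩⟩⟩
      · rw [ha']
        exact addOrderOf_map_eq_of_forall_map_nsmul_eq_zero_iff (loc v) hp fun j' ↦ by
          rw [hloc v x j']; simpa using hℓ.2.2.2 0 v hv j'
      · rw [hb']
        exact addOrderOf_map_eq_of_forall_map_nsmul_eq_zero_iff (loc v) hp fun j' ↦ by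
          rw [hloc v y j']; simpa using hℓ.2.2.2 1 v hv j'
  obtain ⟨T, hT, hTprop⟩ := key
  obtain ⟨ℓ, hℓT, hbℓ⟩ := hT.exists_gt b
  exact ⟨ℓ, hbℓ, hTprop ℓ hℓT⟩

end Summit.BirchSwinnertonDyer.Rank1Residual.JET.Split

end
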